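import Mathlib
import HarnessLib
import Summits.Ventures.LatticeQCDFlow.Exactness.NCMCGeneralSpaceOccupancyChainDoeblinHeatBath

/-!
# The two reported lane acceptance rates converge from EVERY initial configuration

HONEST FRAMING: exact (Metropolis-corrected) sampling algorithms for lattice gauge theory;
figures of merit are autocorrelation/cost numbers at stated couplings and volumes; no
continuum-physics claim.

Venture `LatticeQCDFlow` (cell pub-lqcd), topic `Exactness`; FANOUT row 13 (`eng-snf`, GEN-18).
NEW WORK of the cell, not a published result; no definition is introduced; nothing is cited as a
fact.  GEN-17's `NCMCGeneralSpaceOccupancyChainRates.lean` proved: along the ERGODIC expanded-ensemble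
chain started in `π_c`, the reported acceptance rates of `latflow-snf`'s `run_ncmc_chain` converge,
`acc_fwd → a_F(c) = ∫ min(1, e^{−(W−c)}) dP_F` and `acc_rev → a_R(c)` almost surely — i.e. from
`π_c`-almost every start.  With GEN-18's Doeblin power (`…OccupancyChainDoeblin`, `…DoeblinMirror`)
and the Liouville step (`NCMCGeneralSpaceDoeblinPowerEveryStart`) the exceptional set goes: the
two-time Cesàro event "the empirical `B → C` transition frequency converges" is measurable and
shift-invariant, hence sure from EVERY start.

## Content

* §1 general (`κ` Markov, `π` invariant, `ε • ν ≤ nHit κ m z`, `ε ≠ 0`):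
  `preimage_shift_transitionSet`, `measurableSet_transitionSet` (GEN-17's `tendsto_cesaro_shift_iff`
  applied to the pair sequence `(x_i, x_{i+1})`); **`tendsto_transitionFreq_everyStart_of_nHit_minorised`**
  (`(1/n) #{i<n : x_i ∈ B, x_{i+1} ∈ C} → ∫_B κ(z, C) dπ` from EVERY start),
  **`tendsto_transitionRate_everyStart_of_nHit_minorised`** (`#{B → C}/#{B} → ∫_B κ(z, C) dπ / π(B)`).
* §2 the NCMC lane under ANY two-step minorisation `ε • ν ≤ nHit Q 2 z`:
  **`CrooksPair.ncmc_fwdAcceptRate_everyStart_of_sq`** (`acc_fwd → a_F(c)` from EVERY initial state),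
  **`CrooksPair.ncmc_revAcceptRate_everyStart_of_sq`** (`acc_rev → a_R(c)`); the population values are
  identified with GEN-17's by uniqueness of almost-sure limits under `π_c` (no recomputation).
* §3 **`CrooksPair.ncmc_acceptRates_everyStart_of_exists_sq`** (from the existential certificate of
  `…DoeblinMirror`), **`CrooksPair.ncmc_heatBath_acceptRates_everyStart`** — THE ENGINE WITH HEAT-BATH
  SWEEPS: two bounded densities, heat-bath scans between switches, ANY Crooks pair, ANY `c` with the
  forward work not almost surely `c` (automatic for `c ≠ ΔF`): from EVERY initial state both reported
  acceptance rates converge to `a_F(c)`, `a_R(c)` almost surely.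

NOT CLAIMED: rates of this convergence; the Wilson / Cabibbo–Marinari instances (same assembly).
-/

namespace Summit.Ventures.LatticeQCDFlow.Exactness.GeneralNCMC

open MeasureTheory ProbabilityTheory Set Filter Finset
open scoped ENNReal Topology

/-! ## §1 Empirical transition frequencies from every start -/

section General

variable {S : Type*} [MeasurableSpace S] (κ : Kernel S S) [IsMarkovKernel κ] {π : Measure S}
  [IsProbabilityMeasure π] {m : ℕ} {ε : ℝ≥0∞} {ν : Measure S} [IsProbabilityMeasure ν]

omit [MeasurableSpace S] in
/-- The event "the empirical `B → C` transition frequency converges to `L`" is shift-invariant. -/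
theorem preimage_shift_transitionSet (B C : Set S) (L : ℝ) :
    (fun (x : ℕ → S) (k : ℕ) => x (k + 1)) ⁻¹'
        {x : ℕ → S | Tendsto (fun n : ℕ => (∑ i ∈ range n,
          B.indicator (1 : S → ℝ) (x i) * C.indicator (1 : S → ℝ) (x (i + 1))) / n) atTop (𝓝 L)} =
      {x : ℕ → S | Tendsto (fun n : ℕ => (∑ i ∈ range n,
          B.indicator (1 : S → ℝ) (x i) * C.indicator (1 : S → ℝ) (x (i + 1))) / n) atTop (𝓝 L)} := by
  ext x
  exact tendsto_cesaro_shift_iff (fun p : S × S => B.indicator (1 : S → ℝ) p.1 *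
    C.indicator (1 : S → ℝ) p.2) (fun i => (x i, x (i + 1))) L

/-- The event "the empirical `B → C` transition frequency converges to `L`" is measurable. -/
theorem measurableSet_transitionSet {B C : Set S} (hB : MeasurableSet B) (hC : MeasurableSet C)
    (L : ℝ) :
    MeasurableSet {x : ℕ → S | Tendsto (fun n : ℕ => (∑ i ∈ range n,
          B.indicator (1 : S → ℝ) (x i) * C.indicator (1 : S → ℝ) (x (i + 1))) / n) atTop (𝓝 L)} :=
  measurableSet_tendsto (𝓝 L) fun n =>
    (Finset.measurable_sum (range n) fun i _ =>
      ((measurable_const.indicator hB).comp (measurable_pi_apply i)).mul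
        ((measurable_const.indicator hC).comp (measurable_pi_apply (i + 1)))).div_const _

variable {κ}

/-- **EMPIRICAL TRANSITION FREQUENCIES CONVERGE FROM EVERY START** under a Doeblin power: for
measurable `B`, `C` and EVERY `z`, `P_{δ_z}`-a.s. `(1/n) #{i<n : x_i ∈ B, x_{i+1} ∈ C} → ∫_B κ(y, C) dπ`. -/
theorem tendsto_transitionFreq_everyStart_of_nHit_minorised (hπ : Kernel.Invariant κ π) (hε : ε ≠ 0)
    (hmin : ∀ z, ε • ν ≤ nHit κ m z) {B C : Set S} (hB : MeasurableSet B) (hC : MeasurableSet C)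
    (z : S) :
    ∀ᵐ x ∂(Kernel.trajMeasure (X := fun _ : ℕ => S) (Measure.dirac z)
        (fun n : ℕ => κ.comap (fun h : (j : ↥(Finset.Iic n)) → S => h ⟨n, Finset.mem_Iic.2 le_rfl⟩)
          (measurable_pi_apply _))),
      Tendsto (fun n : ℕ =>
          (∑ i ∈ range n, B.indicator (1 : S → ℝ) (x i) * C.indicator (1 : S → ℝ) (x (i + 1))) / n)
        atTop (𝓝 (∫ y in B, (κ y).real C ∂π)) := by
  have hA := measurableSet_transitionSet (S := S) hB hC (∫ y in B, (κ y).real C ∂π)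
  have hinv := preimage_shift_transitionSet (S := S) B C (∫ y in B, (κ y).real C ∂π)
  have hErg := ergodic_shift_chain_of_nHit_minorised (κ := κ) hπ hε
    (fun z t ht => minorised_setwise hmin z ht)
  have hπA : Kernel.trajMeasure (X := fun _ : ℕ => S) π
      (fun n : ℕ => κ.comap (fun h : (j : ↥(Finset.Iic n)) → S => h ⟨n, Finset.mem_Iic.2 le_rfl⟩)
        (measurable_pi_apply _))
      {x : ℕ → S | Tendsto (fun n : ℕ => (∑ i ∈ range n,
          B.indicator (1 : S → ℝ) (x i) * C.indicator (1 : S → ℝ) (x (i + 1))) / n) atTop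
          (𝓝 (∫ y in B, (κ y).real C ∂π))} = 1 := by
    have h := tendsto_transitionFreq_ae_chain κ hErg hπ hB hC
    rw [ae_iff, ← Set.compl_setOf] at h
    exact (prob_compl_eq_zero_iff hA).1 h
  have h1 := trajMeasure_dirac_eq_one_of_nHit_minorised hπ hε hmin hA hinv hπA z
  rw [ae_iff, ← Set.compl_setOf]
  exact (prob_compl_eq_zero_iff hA).2 h1

/-- **EMPIRICAL TRANSITION RATES CONVERGE FROM EVERY START** under a Doeblin power: for measurable
`B`, `C` with `π(B) ≠ 0` and EVERY `z`, `P_{δ_z}`-a.s.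
`#{i<n : x_i ∈ B, x_{i+1} ∈ C} / #{i<n : x_i ∈ B} → ∫_B κ(y, C) dπ / π(B)`. -/
theorem tendsto_transitionRate_everyStart_of_nHit_minorised (hπ : Kernel.Invariant κ π) (hε : ε ≠ 0)
    (hmin : ∀ z, ε • ν ≤ nHit κ m z) {B C : Set S} (hB : MeasurableSet B) (hC : MeasurableSet C)
    (hB0 : π B ≠ 0) (z : S) :
    ∀ᵐ x ∂(Kernel.trajMeasure (X := fun _ : ℕ => S) (Measure.dirac z)
        (fun n : ℕ => κ.comap (fun h : (j : ↥(Finset.Iic n)) → S => h ⟨n, Finset.mem_Iic.2 le_rfl⟩)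
          (measurable_pi_apply _))),
      Tendsto (fun n : ℕ =>
          (∑ i ∈ range n, B.indicator (1 : S → ℝ) (x i) * C.indicator (1 : S → ℝ) (x (i + 1))) /
            ∑ i ∈ range n, B.indicator (1 : S → ℝ) (x i))
        atTop (𝓝 ((∫ y in B, (κ y).real C ∂π) / π.real B)) := by
  have hBr : π.real B ≠ 0 := by
    rw [measureReal_def, ENNReal.toReal_ne_zero]
    exact ⟨hB0, measure_ne_top π B⟩
  have h1 := tendsto_transitionFreq_everyStart_of_nHit_minorised hπ hε hmin hB hC z
  have h2 := tendsto_sum_div_everyStart_of_nHit_minorised hπ hε hmin (φ := B.indicator (1 : S → ℝ))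
    (measurable_const.indicator hB)
    (show Integrable (B.indicator (1 : S → ℝ)) π from (integrable_const (1 : ℝ)).indicator hB) z
  rw [integral_indicator_one hB] at h2
  filter_upwards [h1, h2] with x hx1 hx2
  refine ((hx1.div hx2 hBr).congr' ?_)
  filter_upwards [eventually_gt_atTop 0] with n hn
  have hn' : (n : ℝ) ≠ 0 := by exact_mod_cast hn.ne'
  rw [Pi.div_apply, div_div_div_cancel_right₀ hn']

end General

/-! ## §2 The NCMC lane: both acceptance rates from every start -/

section NCMC

variable {Ω E : Type*} [MeasurableSpace Ω] [MeasurableSpace E]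
  {ν₀ ν₁ : Measure Ω} [IsFiniteMeasure ν₀] [IsFiniteMeasure ν₁]
  {κF κR : Kernel Ω E} [IsMarkovKernel κF] [IsMarkovKernel κR] {s e : E → Ω} {W : E → ℝ} {c : ℝ}
  {T₀ T₁ : Kernel Ω Ω} [IsMarkovKernel T₀] [IsMarkovKernel T₁] {ε : ℝ≥0∞}
  {ν : Measure (Bool × Ω)} [IsProbabilityMeasure ν]

/-- **`acc_fwd → a_F(c)` FROM EVERY INITIAL STATE.**  Crooks pair between finite non-zero weights,
invariant level samplers, any two-step minorisation `ε • ν ≤ nHit Q 2 z` (`ε ≠ 0`): for EVERY `z`,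
along the NCMC chain started at `z` the reported forward acceptance rate converges to
`a_F(c) = ∫ min(1, e^{−(W−c)}) dP_F` almost surely. -/
theorem CrooksPair.ncmc_fwdAcceptRate_everyStart_of_sq (h : CrooksPair ν₀ ν₁ κF κR s e W)
    (h0 : ν₀ univ ≠ 0) (hT₀ : Kernel.Invariant T₀ ν₀) (hT₁ : Kernel.Invariant T₁ ν₁) (hε : ε ≠ 0)
    (hD : haveI := isMarkovKernel_switchKernel (κF := κF) (κR := κR) (c := c)
              h.measurable_W h.measurable_s h.measurable_e
      ∀ z, ε • ν ≤ nHit (switchKernel κF κR c W s e ∘ₖ levelKernel T₀ T₁) 2 z) (z : Bool × Ω) :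
    haveI := isMarkovKernel_switchKernel (κF := κF) (κR := κR) (c := c)
      h.measurable_W h.measurable_s h.measurable_e
    haveI := isMarkovKernel_levelKernel T₀ T₁
    ∀ᵐ x ∂(Kernel.trajMeasure (X := fun _ : ℕ => Bool × Ω) (Measure.dirac z)
        (fun n : ℕ => (switchKernel κF κR c W s e ∘ₖ levelKernel T₀ T₁).comap
          (fun hh : (j : ↥(Finset.Iic n)) → Bool × Ω => hh ⟨n, Finset.mem_Iic.2 le_rfl⟩)
          (measurable_pi_apply _))),
      Tendsto (fun n : ℕ =>
          (∑ i ∈ range n, (targetLevel Ω)ᶜ.indicator (1 : Bool × Ω → ℝ) (x i) *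
              (targetLevel Ω).indicator (1 : Bool × Ω → ℝ) (x (i + 1))) /
            ∑ i ∈ range n, (targetLevel Ω)ᶜ.indicator (1 : Bool × Ω → ℝ) (x i))
        atTop (𝓝 (∫ ε, min 1 (Real.exp (-(W ε - c))) ∂(fwdPathLaw ν₀ κF))) := by
  haveI := isMarkovKernel_switchKernel (κF := κF) (κR := κR) (c := c)
    h.measurable_W h.measurable_s h.measurable_e
  haveI := isMarkovKernel_levelKernel T₀ T₁
  haveI := isProbabilityMeasure_jointLaw c ν₀ ν₁ h0
  haveI := isFiniteMeasure_jointWeight c ν₀ ν₁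
  set Q := switchKernel κF κR c W s e ∘ₖ levelKernel T₀ T₁ with hQ
  have hπ : Kernel.Invariant Q ((jointWeight c ν₀ ν₁ univ)⁻¹ • jointWeight c ν₀ ν₁) :=
    invariant_smul Q (iteration_invariant h hT₀ hT₁ c) _
  have hF0 : ((jointWeight c ν₀ ν₁ univ)⁻¹ • jointWeight c ν₀ ν₁) (targetLevel Ω)ᶜ ≠ 0 := by
    rw [Measure.smul_apply, smul_eq_mul, jointWeight_compl_targetLevel]
    exact mul_ne_zero (ENNReal.inv_ne_zero.2 (measure_ne_top _ _)) h0
  -- the value of the limit is GEN-17's, by uniqueness of almost sure limits under `π_c`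
  have hErg := ergodic_shift_chain_of_nHit_minorised (κ := Q) hπ hε
    (fun z t ht => minorised_setwise hD z ht)
  have hval : (∫ y in (targetLevel Ω)ᶜ, (Q y).real (targetLevel Ω)
      ∂((jointWeight c ν₀ ν₁ univ)⁻¹ • jointWeight c ν₀ ν₁)) /
      ((jointWeight c ν₀ ν₁ univ)⁻¹ • jointWeight c ν₀ ν₁).real (targetLevel Ω)ᶜ =
      ∫ ε, min 1 (Real.exp (-(W ε - c))) ∂(fwdPathLaw ν₀ κF) := by
    obtain ⟨x, hx1, hx2⟩ := ((tendsto_transitionRate_ae_chain Q hErg hπ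
      measurableSet_targetLevel.compl measurableSet_targetLevel hF0).and
      (h.tendsto_fwdAcceptRate_ae_chain h0 hT₀ hT₁ c hErg)).exists
    exact tendsto_nhds_unique hx1 hx2
  rw [← hval]
  exact tendsto_transitionRate_everyStart_of_nHit_minorised hπ hε hD
    measurableSet_targetLevel.compl measurableSet_targetLevel hF0 z

/-- **`acc_rev → a_R(c)` FROM EVERY INITIAL STATE** (`Z₁ ≠ 0`): the reported reverse acceptance
rate converges to `a_R(c) = ∫ min(1, e^{W−c}) dP_R` almost surely along the chain from every `z`. -/
theorem CrooksPair.ncmc_revAcceptRate_everyStart_of_sq (h : CrooksPair ν₀ ν₁ κF κR s e W)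
    (h0 : ν₀ univ ≠ 0) (h1 : ν₁ univ ≠ 0) (hT₀ : Kernel.Invariant T₀ ν₀)
    (hT₁ : Kernel.Invariant T₁ ν₁) (hε : ε ≠ 0)
    (hD : haveI := isMarkovKernel_switchKernel (κF := κF) (κR := κR) (c := c)
              h.measurable_W h.measurable_s h.measurable_e
      ∀ z, ε • ν ≤ nHit (switchKernel κF κR c W s e ∘ₖ levelKernel T₀ T₁) 2 z) (z : Bool × Ω) :
    haveI := isMarkovKernel_switchKernel (κF := κF) (κR := κR) (c := c)
      h.measurable_W h.measurable_s h.measurable_e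
    haveI := isMarkovKernel_levelKernel T₀ T₁
    ∀ᵐ x ∂(Kernel.trajMeasure (X := fun _ : ℕ => Bool × Ω) (Measure.dirac z)
        (fun n : ℕ => (switchKernel κF κR c W s e ∘ₖ levelKernel T₀ T₁).comap
          (fun hh : (j : ↥(Finset.Iic n)) → Bool × Ω => hh ⟨n, Finset.mem_Iic.2 le_rfl⟩)
          (measurable_pi_apply _))),
      Tendsto (fun n : ℕ =>
          (∑ i ∈ range n, (targetLevel Ω).indicator (1 : Bool × Ω → ℝ) (x i) *
              (targetLevel Ω)ᶜ.indicator (1 : Bool × Ω → ℝ) (x (i + 1))) /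
            ∑ i ∈ range n, (targetLevel Ω).indicator (1 : Bool × Ω → ℝ) (x i))
        atTop (𝓝 (∫ ε, min 1 (Real.exp (W ε - c)) ∂(fwdPathLaw ν₁ κR))) := by
  haveI := isMarkovKernel_switchKernel (κF := κF) (κR := κR) (c := c)
    h.measurable_W h.measurable_s h.measurable_e
  haveI := isMarkovKernel_levelKernel T₀ T₁
  haveI := isProbabilityMeasure_jointLaw c ν₀ ν₁ h0
  haveI := isFiniteMeasure_jointWeight c ν₀ ν₁
  set Q := switchKernel κF κR c W s e ∘ₖ levelKernel T₀ T₁ with hQ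
  have hπ : Kernel.Invariant Q ((jointWeight c ν₀ ν₁ univ)⁻¹ • jointWeight c ν₀ ν₁) :=
    invariant_smul Q (iteration_invariant h hT₀ hT₁ c) _
  have hec : ENNReal.ofReal (Real.exp c) ≠ 0 := by
    rw [ne_eq, ENNReal.ofReal_eq_zero, not_le]; exact Real.exp_pos c
  have hT0 : ((jointWeight c ν₀ ν₁ univ)⁻¹ • jointWeight c ν₀ ν₁) (targetLevel Ω) ≠ 0 := by
    rw [Measure.smul_apply, smul_eq_mul, jointWeight_targetLevel]
    exact mul_ne_zero (ENNReal.inv_ne_zero.2 (measure_ne_top _ _)) (mul_ne_zero hec h1)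
  have hErg := ergodic_shift_chain_of_nHit_minorised (κ := Q) hπ hε
    (fun z t ht => minorised_setwise hD z ht)
  have hval : (∫ y in targetLevel Ω, (Q y).real (targetLevel Ω)ᶜ
      ∂((jointWeight c ν₀ ν₁ univ)⁻¹ • jointWeight c ν₀ ν₁)) /
      ((jointWeight c ν₀ ν₁ univ)⁻¹ • jointWeight c ν₀ ν₁).real (targetLevel Ω) =
      ∫ ε, min 1 (Real.exp (W ε - c)) ∂(fwdPathLaw ν₁ κR) := by
    obtain ⟨x, hx1, hx2⟩ := ((tendsto_transitionRate_ae_chain Q hErg hπ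
      measurableSet_targetLevel measurableSet_targetLevel.compl hT0).and
      (h.tendsto_revAcceptRate_ae_chain h0 h1 hT₀ hT₁ c hErg)).exists
    exact tendsto_nhds_unique hx1 hx2
  rw [← hval]
  exact tendsto_transitionRate_everyStart_of_nHit_minorised hπ hε hD
    measurableSet_targetLevel measurableSet_targetLevel.compl hT0 z

/-! ## §3 From the existential certificate; the engine with heat-bath sweeps -/

/-- **Both acceptance rates from every start, from an existential two-step certificate.** -/
theorem CrooksPair.ncmc_acceptRates_everyStart_of_exists_sq (h : CrooksPair ν₀ ν₁ κF κR s e W)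
    (h0 : ν₀ univ ≠ 0) (h1 : ν₁ univ ≠ 0) (hT₀ : Kernel.Invariant T₀ ν₀)
    (hT₁ : Kernel.Invariant T₁ ν₁)
    (hex : ∃ (ε : ℝ≥0∞) (ν : Measure (Bool × Ω)), IsProbabilityMeasure ν ∧ ε ≠ 0 ∧
      ∀ z, ε • ν ≤ nHit (switchKernel κF κR c W s e ∘ₖ levelKernel T₀ T₁) 2 z) (z : Bool × Ω) :
    haveI := isMarkovKernel_switchKernel (κF := κF) (κR := κR) (c := c)
      h.measurable_W h.measurable_s h.measurable_e
    haveI := isMarkovKernel_levelKernel T₀ T₁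
    ∀ᵐ x ∂(Kernel.trajMeasure (X := fun _ : ℕ => Bool × Ω) (Measure.dirac z)
        (fun n : ℕ => (switchKernel κF κR c W s e ∘ₖ levelKernel T₀ T₁).comap
          (fun hh : (j : ↥(Finset.Iic n)) → Bool × Ω => hh ⟨n, Finset.mem_Iic.2 le_rfl⟩)
          (measurable_pi_apply _))),
      Tendsto (fun n : ℕ =>
          (∑ i ∈ range n, (targetLevel Ω)ᶜ.indicator (1 : Bool × Ω → ℝ) (x i) *
              (targetLevel Ω).indicator (1 : Bool × Ω → ℝ) (x (i + 1))) /
            ∑ i ∈ range n, (targetLevel Ω)ᶜ.indicator (1 : Bool × Ω → ℝ) (x i))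
          atTop (𝓝 (∫ ε, min 1 (Real.exp (-(W ε - c))) ∂(fwdPathLaw ν₀ κF))) ∧
        Tendsto (fun n : ℕ =>
            (∑ i ∈ range n, (targetLevel Ω).indicator (1 : Bool × Ω → ℝ) (x i) *
                (targetLevel Ω)ᶜ.indicator (1 : Bool × Ω → ℝ) (x (i + 1))) /
              ∑ i ∈ range n, (targetLevel Ω).indicator (1 : Bool × Ω → ℝ) (x i))
          atTop (𝓝 (∫ ε, min 1 (Real.exp (W ε - c)) ∂(fwdPathLaw ν₁ κR))) := by
  obtain ⟨ε, ν, hν, hε, hD⟩ := hex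
  haveI := hν
  filter_upwards [h.ncmc_fwdAcceptRate_everyStart_of_sq h0 hT₀ hT₁ hε hD z,
    h.ncmc_revAcceptRate_everyStart_of_sq h0 h1 hT₀ hT₁ hε hD z] with x hx1 hx2
  exact ⟨hx1, hx2⟩

end NCMC

section HeatBath

variable {ι : Type*} [Fintype ι] [DecidableEq ι] {X : ι → Type*} [∀ i, MeasurableSpace (X i)]
variable {μ : Π i, Measure (X i)} [∀ i, IsProbabilityMeasure (μ i)]

/-- **THE ENGINE WITH HEAT-BATH SWEEPS: BOTH REPORTED ACCEPTANCE RATES CONVERGE FROM EVERY INITIAL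
STATE.**  Two bounded densities `p₀`, `p₁` against one product reference, heat-bath scans for
`p₀` / `p₁` as level samplers, ANY Crooks pair, ANY `c` with the forward work not almost surely equal
to `c`: from EVERY initial state `z`, `acc_fwd → a_F(c)` and `acc_rev → a_R(c)` almost surely. -/
theorem CrooksPair.ncmc_heatBath_acceptRates_everyStart {p₀ p₁ : (Π j, X j) → ℝ≥0∞}
    {m₀ M₀ m₁ M₁ : ℝ≥0∞}
    (hp₀ : Measurable p₀) (hm₀0 : m₀ ≠ 0) (hM₀ : M₀ ≠ ∞) (hmp₀ : ∀ ω, m₀ ≤ p₀ ω)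
    (hpM₀ : ∀ ω, p₀ ω ≤ M₀) {l₀ : List ι} (hl₀ : ∀ i, i ∈ l₀)
    (hp₁ : Measurable p₁) (hm₁0 : m₁ ≠ 0) (hM₁ : M₁ ≠ ∞) (hmp₁ : ∀ ω, m₁ ≤ p₁ ω)
    (hpM₁ : ∀ ω, p₁ ω ≤ M₁) {l₁ : List ι} (hl₁ : ∀ i, i ∈ l₁)
    {E : Type*} [MeasurableSpace E] {κF κR : Kernel (Π j, X j) E} [IsMarkovKernel κF]
    [IsMarkovKernel κR] {s e : E → Π j, X j} {W : E → ℝ}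
    (h : CrooksPair ((Measure.pi μ).withDensity p₀) ((Measure.pi μ).withDensity p₁) κF κR s e W)
    (c : ℝ) (hW : (((Measure.pi μ).withDensity p₀).bind κF) {ε | W ε ≠ c} ≠ 0) :
    ∃ (_ : IsMarkovKernel (switchKernel κF κR c W s e))
      (_ : IsMarkovKernel (levelKernel (cycle (l₀.map (siteHeatBath μ p₀)))
        (cycle (l₁.map (siteHeatBath μ p₁)))))
      (_ : IsFiniteMeasure ((Measure.pi μ).withDensity p₀))
      (_ : IsFiniteMeasure ((Measure.pi μ).withDensity p₁)),
      ∀ z : Bool × (Π j, X j), ∀ᵐ x ∂(Kernel.trajMeasure (X := fun _ : ℕ => Bool × (Π j, X j))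
          (Measure.dirac z)
          (fun n : ℕ => (switchKernel κF κR c W s e ∘ₖ
            levelKernel (cycle (l₀.map (siteHeatBath μ p₀))) (cycle (l₁.map (siteHeatBath μ p₁)))).comap
            (fun hh : (j : ↥(Finset.Iic n)) → Bool × (Π j, X j) => hh ⟨n, Finset.mem_Iic.2 le_rfl⟩)
            (measurable_pi_apply _))),
        Tendsto (fun n : ℕ =>
            (∑ i ∈ range n, (targetLevel (Π j, X j))ᶜ.indicator (1 : Bool × (Π j, X j) → ℝ) (x i) *
                (targetLevel (Π j, X j)).indicator (1 : Bool × (Π j, X j) → ℝ) (x (i + 1))) /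
              ∑ i ∈ range n, (targetLevel (Π j, X j))ᶜ.indicator (1 : Bool × (Π j, X j) → ℝ) (x i))
          atTop (𝓝 (∫ ε, min 1 (Real.exp (-(W ε - c)))
            ∂(fwdPathLaw ((Measure.pi μ).withDensity p₀) κF))) ∧
        Tendsto (fun n : ℕ =>
            (∑ i ∈ range n, (targetLevel (Π j, X j)).indicator (1 : Bool × (Π j, X j) → ℝ) (x i) *
                (targetLevel (Π j, X j))ᶜ.indicator (1 : Bool × (Π j, X j) → ℝ) (x (i + 1))) /
              ∑ i ∈ range n, (targetLevel (Π j, X j)).indicator (1 : Bool × (Π j, X j) → ℝ) (x i))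
          atTop (𝓝 (∫ ε, min 1 (Real.exp (W ε - c))
            ∂(fwdPathLaw ((Measure.pi μ).withDensity p₁) κR))) := by
  obtain ⟨hMk₀, hfin₀, -, -, h0, -, hK₀, -⟩ := heatBathSweep_package (μ := μ) hp₀ hm₀0
    hM₀ hmp₀ hpM₀ hl₀
  obtain ⟨hMk₁, hfin₁, -, -, h1, -, hK₁, -⟩ := heatBathSweep_package (μ := μ) hp₁ hm₁0
    hM₁ hmp₁ hpM₁ hl₁
  obtain ⟨hmfin₀, hm₀, hmin₀, hac₀⟩ := heatBath_minorising (μ := μ) hp₀ hm₀0 hM₀ hmp₀ hpM₀ hl₀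
  obtain ⟨hmfin₁, hm₁, hmin₁, hac₁⟩ := heatBath_minorising (μ := μ) hp₁ hm₁0 hM₁ hmp₁ hpM₁ hl₁
  haveI := hMk₀
  haveI := hMk₁
  haveI := hfin₀
  haveI := hfin₁
  haveI := hmfin₀
  haveI := hmfin₁
  refine ⟨isMarkovKernel_switchKernel (κF := κF) (κR := κR) (c := c)
      h.measurable_W h.measurable_s h.measurable_e, isMarkovKernel_levelKernel _ _, hfin₀, hfin₁,
    fun z => ?_⟩
  exact h.ncmc_acceptRates_everyStart_of_exists_sq h0 h1 hK₀ hK₁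
    (h.ncmc_exists_sq_doeblin hm₀ hm₁ hmin₀ hmin₁ hac₀ hac₁ c hW) z

end HeatBath

end Summit.Ventures.LatticeQCDFlow.Exactness.GeneralNCMC
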